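import Summits.HodgeConjecture.HodgeConjecture.Theorems.F0P3cCMLocalNonsplitBorelTransportU2   -- ★ `localNonsplitEquiv_mem_torusU_iff₂` (torus ↔ torus under the one-place model of `U(Φ₂)`)
import Literature.NumberTheory.Automorphic.CMLocalNonsplitBorelTransport            -- ★ `mem_range_glDiagonal_iff_isDiag`
import Literature.NumberTheory.Automorphic.U2JacquetVanishingSupercuspidalOfCartan   -- ★ `exists_coe_eq_diagonal_uniformizer_two` (the ray `d(β, (σβ)⁻¹) ∈ U(σ, Φ₂)`)
import HarnessLib

/-!
# F0 · P3c · line LH6 «StCharTS» — road (D) brick «A2-RAY»: the torus ray `d(β, (σ_w β)⁻¹)` of `U(Φ₂)(L⁺_v)` through the one-place model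
# (the `N = 2` twin of ★ `CMBorelAdmissibleTorusRay.exists_torus_coe_localNonsplitEquiv_eq_diagonal`)

Cell `hodgecm-mathlib`, crux H413 = `stmt-HodgeConjecture-24833` (lane `--supports … --as helper`); road (D) «DEEP-FL» owner LH6-p04 (g3), deal 2026-09-02T06:45:40Z
(i) to LH5-p05 (g2).  THEOREMS ONLY; no definition, no instance, no notation, no named fact, no `sorry`.  Consumer: the INPUT `(a₂, ha₂)` of (U2-B)
`exists_cmIwahoriDatum₂` (LH4-p02 (g3)) — the Iwahori datum of `B₂ ≤ U(Φ₂)(L⁺_v)` along the ray of XIG's scalar `α` (`|α|_w < 1`).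
HONEST LABEL: count-neutral; HC_CM is proved only modulo the 7 printed citations (2 remaining: hLiu418 = stmt-HodgeConjecture-24832, h413 =
stmt-HodgeConjecture-24833) until rung 0 closes.

* `exists_torus_coe_localNonsplitEquiv_eq_diagonal_two` — for `β ≠ 0` in `L_w` there is `a₂ ∈ (cmBorelTriple L 2 v).M` with `E₂ a₂ = d(β, (σ_w β)⁻¹)`
  (★ `exists_coe_eq_diagonal_uniformizer_two` in the model, pulled back along `E₂.symm`).

## References
* [Rogawski1990] J. D. Rogawski, *Automorphic Representations of Unitary Groups in Three Variables* (1990), §1.10 p. 9, §12.1 p. 171.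
* [PlatonovRapinchuk1994] V. Platonov, A. Rapinchuk, *Algebraic Groups and Number Theory* (1994), §5.1 (the one-place model).
-/

set_option autoImplicit false
set_option linter.dupNamespace false

noncomputable section

open scoped MatrixGroups
open Literature.NumberTheory.Automorphic Literature.NumberTheory.Automorphic.UnitaryGroup
open _root_.NumberField _root_.IsDedekindDomain

-- the mandated namespace has the single-problem summit's repeated segment (`HodgeConjecture.HodgeConjecture`)
namespace Summit.HodgeConjecture.HodgeConjecture.Cruxes.H413.F0P3cStCharTSA2Ray

variable (L : Type) [Field L] [NumberField L] [IsCMField L] (v : HeightOneSpectrum (𝓞 ↥(maximalRealSubfield L)))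
  (w : PlacesOver L v) (hw : IsCMField.complexConj L • w.1 = w.1)

/-- **«A2-RAY» — existence of the ray in `T₂(L⁺_v)`**: for `β ≠ 0` in `L_w` there is a CM torus element `a₂ ∈ (cmBorelTriple L 2 v).M` whose model matrix is
`d(β, (σ_w β)⁻¹)` (★ `exists_coe_eq_diagonal_uniformizer_two` in the model — `β` need not be a uniformiser — pulled back along `E₂.symm`, torus membership by ★
`localNonsplitEquiv_mem_torusU_iff₂`).  The input `(a₂, ha₂)` of the `N = 2` Iwahori-datum package (U2-B). [cite: Rogawski1990, §1.10 p. 9] [cite: PlatonovRapinchuk1994, §5.1] -/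
theorem exists_torus_coe_localNonsplitEquiv_eq_diagonal_two {β : w.1.adicCompletion L} (hβ0 : β ≠ 0) :
    ∃ b : ↥(cmBorelTriple L 2 v).M,
      (((localNonsplitEquiv (IsCMField.complexConj L) (Matrix.of fun i j : Fin 2 => if i.val + j.val + 1 = 2 then (1 : L) else 0)
          (IsCMField.complexConj_ne_one L) w hw
          (b : ↥(unitaryGroupOfForm (conjLocal L (IsCMField.complexConj L) v) (cmLocalForm L 2 v))) :
        ↥(unitaryGroupOfForm (galAdicCompletionMap (L := L) (IsCMField.complexConj L) hw)
          (placeForm (Matrix.of fun i j : Fin 2 => if i.val + j.val + 1 = 2 then (1 : L) else 0) w.1))) :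
          GL (Fin 2) (w.1.adicCompletion L)) : Matrix (Fin 2) (Fin 2) (w.1.adicCompletion L)) =
      Matrix.diagonal ![β, (galAdicCompletionMap (L := L) (IsCMField.complexConj L) hw β)⁻¹] := by
  have hJw : placeForm (Matrix.of fun i j : Fin 2 => if i.val + j.val + 1 = 2 then (1 : L) else 0) w.1 =
      (StdForm.antidiagonal 2).over (w.1.adicCompletion L) := by
    rw [placeForm, antidiagOne_eq_over, StdForm.over_map]
  have hσσ : ∀ x, (galAdicCompletionMap (L := L) (IsCMField.complexConj L) hw)
      ((galAdicCompletionMap (L := L) (IsCMField.complexConj L) hw) x) = x :=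
    galAdicCompletionMap_galAdicCompletionMap_of_smul_eq (IsCMField.complexConj L) w (IsCMField.complexConj_ne_one L) hw
  obtain ⟨a, ha⟩ := exists_coe_eq_diagonal_uniformizer_two (galAdicCompletionMap (L := L) (IsCMField.complexConj L) hw) hJw hσσ hβ0
  -- `a ∈ T(L_w)`: its matrix is diagonal
  have haT : a ∈ torusU (galAdicCompletionMap (L := L) (IsCMField.complexConj L) hw)
      (placeForm (Matrix.of fun i j : Fin 2 => if i.val + j.val + 1 = 2 then (1 : L) else 0) w.1) := by
    refine (mem_torusU_iff _).2 (MonoidHom.mem_range.1 ((mem_range_glDiagonal_iff_isDiag _).2 ?_))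
    rw [ha]
    exact Matrix.isDiag_diagonal _
  set e := localNonsplitEquiv (IsCMField.complexConj L) (Matrix.of fun i j : Fin 2 => if i.val + j.val + 1 = 2 then (1 : L) else 0)
    (IsCMField.complexConj_ne_one L) w hw with he
  have hmem : e.symm a ∈ (cmBorelTriple L 2 v).M := by
    rw [← F0P3cCMLocalNonsplitBorelTransportU2.localNonsplitEquiv_mem_torusU_iff₂ L v w hw, ← he, ContinuousMulEquiv.apply_symm_apply]
    exact haT
  refine ⟨⟨e.symm a, hmem⟩, ?_⟩
  change (((e (e.symm a)) : GL (Fin 2) (w.1.adicCompletion L)) : Matrix (Fin 2) (Fin 2) (w.1.adicCompletion L)) = _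
  rw [ContinuousMulEquiv.apply_symm_apply, ha]

end Summit.HodgeConjecture.HodgeConjecture.Cruxes.H413.F0P3cStCharTSA2Ray

end
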